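import Literature.NumberTheory.LFunctions.ExplicitDeuringHeilbronnDirichlet
import HarnessLib

/-!
# An explicit hybrid bound of Weyl strength `1/6` for `L(1/2 + it, χ)` to sixth-power moduli
# (Hiary 2016, §1 Corollary 1)

Topic `Literature/NumberTheory/LFunctions` (namespace `Literature.NumberTheory.LFunctions`; the
paper's object `𝔮 = q|t|` in the sub-namespace `Hiary2016`). STATEMENT LAYER (D-0014: ONE named fact, the
source's Corollary 1; the §1 convexity-type displays (1.2) `124.46 𝔮^{1/4}` and (1.4)
`4q^{1/4}√((|t|+1) log q)` are quoted below for context only — the tree's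
`BGTZ2025.proposition24_thornerZaman` already carries an explicit `θ = 1/4` bound for all `t`), typed for the cell `landau-siegel` (rung F-S3, family B-dh,
E(d) row dhE-03 = registry E-037 «explicit subconvexity inputs of Benli–Goel–Twiss–Zaman's Theorem 1.3»:
the instance `θ = 1/6`). The registry question was whether an EXPLICIT hybrid bound of Weyl strength
`|L(1/2+it,χ)| ≤ A (q(1+|t|))^{1/6+o(1)}` is in print. Answer recorded here: YES for POWERFULL moduli
(Hiary's Corollary 1: `q` a sixth power), NO for general `q` (Hiary's Theorem 2 carries the
square-free / cube-full parts of `q`; Petrow–Young's Weyl bound for all `q` is inexplicit) — so for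
Zhang's moduli `pD`, `p` prime, the `θ = 1/6` instance of `BGTZ2025.HypothesisA` stays open in print.
A NAMED FACT (closed `Prop` with cite), not proved here.

Source: G. A. Hiary, *An explicit hybrid estimate for `L(1/2+it,χ)`*, Acta Arith. **176** (2016)
211–239, doi:10.4064/aa8433-7-2016 = arXiv:1510.00950 [Hiary2016], §1, read on the held copy
`paper:arxiv-1510.00950` p. 3 (p0003:L1–L100).

## What the source prints (verbatim)

§1: "Let `χ` be a Dirichlet character modulo `q`. … Let `τ(q)` be the number of divisors of `q`. If
`|t| ≥ 3`, say, we define the analytic conductor of `L(1/2+it,χ)` to be `𝔮 := q|t|`." "… if `χ` is a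
primitive character [footnote: We consider the principal character as neither primitive nor
imprimitive] modulo `q > 1`, then we have the convexity bound
(1.2) `|L(1/2+it,χ)| ≤ 124.46 𝔮^{1/4}`, (`𝔮 ≥ 10⁹`, `|t| ≥ √q`)." "Using partial summation, we obtain
an explicit bound applicable for any `t`. Specifically, if `χ` is primitive modulo `q > 1`, then we
obtain in §6 that (1.4) `|L(1/2+it,χ)| ≤ 4 q^{1/4} √((|t|+1) log q)`." "**Corollary 1.** Let `χ` be a
primitive Dirichlet character modulo `q`. If `q` is a sixth power, then
`|L(1/2+it,χ)| ≤ 9.05 τ(q) 𝔮^{1/6} log^{3/2} 𝔮`, (`|t| ≥ 200`)." ("This theorem supplies the first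
example of an explicit hybrid Weyl bound (i.e. with `κ₂ = 1/6` …) for an infinite set of Dirichlet
`L`-functions; namely, the set of Dirichlet `L`-functions corresponding to powerfull moduli.")

## Lean rendering / design choices

* `L(s,χ) = DirichletCharacter.LFunction χ s` (Mathlib); `|L(1/2+it,χ)|` is the norm at
  `1/2 + t·I`, as in the tree's `BGTZ2025.HypothesisA`.
* "`χ` primitive modulo `q`" with the source's convention that the principal character is not
  primitive: the hypotheses `1 < q` and `χ.IsPrimitive` (`q = 1 = 1⁶` would be `ζ`, excluded).
* `𝔮 = q|t|` is `Hiary2016.frakq q t`; `τ(q)` is `(Nat.divisors q).card`; `log^{3/2} 𝔮` is the real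
  power `(log 𝔮)^{3/2}` (`Real.rpow`; for `|t| ≥ 200`, `q ≥ 2`, `log 𝔮 > 0`), `𝔮^{1/6}`, `𝔮^{1/4}`,
  `q^{1/4}` likewise; "`q` is a sixth power" is `∃ m : ℕ, q = m ^ 6`.
* Constants verbatim: `9.05`, `200`.

WHAT THIS IS NOT: nothing is proved here; no claim about Landau–Siegel zeros. The tree's explicit
CONVEXITY bound with exponent `1/4` in the `(1 + |t|)` normalisation is
`BGTZ2025.proposition24_thornerZaman` (Thorner–Zaman 2024, Prop. 2.10, `2.97655 (q(1+|t|))^{1/4}`);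
the explicit Burgess-strength `θ = 3/16` instance is `ExplicitBurgessBoundDirichlet.lean` (Francis);
the inexplicit Weyl bound for all `q` is `PetrowYoungWeylBound.lean`; none is restated. No instance, no
notation.

«The programme SEARCHES and TYPES; no claim about Landau–Siegel zeros, Theorems 1–2 of
arXiv:2211.02515 or a repaired Margin232 until a kernel theorem says so.»

## References

* [Hiary2016] G. A. Hiary, Acta Arith. 176 (2016) 211–239, arXiv:1510.00950 — §1 Corollary 1,
  (1.2), (1.4) (p. 3 of the arXiv version).
* [BenliGoelTwissZaman2025] Hypothesis 2.1 / Theorem 1.3 (the consumer of such bounds; tree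
  `BGTZ2025.HypothesisA`, `BGTZ2025.theorem13`).
-/

noncomputable section

open Complex

namespace Literature.NumberTheory.LFunctions

namespace Hiary2016

/-- The analytic conductor `𝔮 := q|t|` of `L(1/2+it,χ)` (`|t| ≥ 3`). [cite: Hiary2016, §1 (definition of 𝔮)] -/
def frakq (q : ℕ) (t : ℝ) : ℝ := (q : ℝ) * |t|

end Hiary2016

open Hiary2016

/-- **Hiary 2016, Corollary 1 (explicit hybrid Weyl bound for sixth-power moduli; NAMED FACT, as
printed).** "Let `χ` be a primitive Dirichlet character modulo `q`. If `q` is a sixth power, then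
`|L(1/2+it,χ)| ≤ 9.05 τ(q) 𝔮^{1/6} log^{3/2} 𝔮`, (`|t| ≥ 200`)", `𝔮 = q|t|`, `τ(q)` the number of
divisors of `q`; `q > 1` (the source's convention that the principal character is not primitive).
Not proved here (van der Corput / `q`-analogue of Weyl differencing for powerfull moduli, §§2–6).
[cite: Hiary2016, Corollary 1] -/
def hiary2016_corollary1 : Prop :=
  ∀ (q : ℕ) [NeZero q], 1 < q → (∃ m : ℕ, q = m ^ 6) →
    ∀ χ : DirichletCharacter ℂ q, χ.IsPrimitive → ∀ t : ℝ, 200 ≤ |t| →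
      ‖χ.LFunction (1 / 2 + t * I)‖ ≤
        9.05 * ((Nat.divisors q).card : ℝ) * frakq q t ^ ((1 : ℝ) / 6) *
          Real.log (frakq q t) ^ ((3 : ℝ) / 2)

/-! ### Bookkeeping (proved) -/

/-- For `|t| ≥ 200` and `q ≥ 2` the analytic conductor satisfies `𝔮 = q|t| ≥ 400`, so `log 𝔮 > 0`
and the right-hand side of Corollary 1 is a genuine positive quantity. [cite: Hiary2016, Corollary 1] -/
theorem Hiary2016.frakq_ge {q : ℕ} (hq : 1 < q) {t : ℝ} (ht : 200 ≤ |t|) : 400 ≤ frakq q t := by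
  unfold frakq
  have hq2 : (2 : ℝ) ≤ q := by exact_mod_cast hq
  nlinarith [abs_nonneg t]

/-- `log 𝔮 > 0` in the range of Corollary 1. [cite: Hiary2016, Corollary 1] -/
theorem Hiary2016.log_frakq_pos {q : ℕ} (hq : 1 < q) {t : ℝ} (ht : 200 ≤ |t|) :
    0 < Real.log (frakq q t) :=
  Real.log_pos (by linarith [Hiary2016.frakq_ge hq ht])

end Literature.NumberTheory.LFunctions

end
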